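/-
Copyright (c) 2026 the pub-hodgecm-mathlib formalisation cell (harness21).  Prover seat hodgecm-mathlib-K2E1-p09 (g5), Track B ∕ K2-LIT,
h413 = `stmt-HodgeConjecture-24833`, line `K2_E1_TraceFormulaBeta`, page «EIS-RANK-ONE», deal [D1] «EIS-R6d₂-residuals → R6e-inputs (N = 2)» of the
dealer K2E1-plan (g3) 2026-09-04T05:34:55Z, part (D1-c) PART I (ruling «R6d-FIBREWISE» 05:44:38Z): the big-cell section ALONG THE LINE,
`Φ_g(t) = f(ι(w₀) · n(θ t) · g)` on `𝔸_F` — line algebra, level periodicity in the finite coordinate, continuity, integrability, and Poisson's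
locally uniform majorant `hloc`, for ANY `f` (archimedean-free half; PART II = the archimedean Fourier decay from `hφ∞`).
-/
import Summits.HodgeConjecture.HodgeConjecture.Theorems.K2E1BigCellLineDilationU2           -- ★ (b-i) `chart_add`; transitively ★ (a) `toAdelic_eq_chart_of_coe_eq`, `exists_unipotentU_two_coe_eq`
import Summits.HodgeConjecture.HodgeConjecture.Theorems.K2E1EisensteinIntertwiningU         -- ★ `integrable_intertwiningU_integrand_quasiSplit_two` (absolute convergence of `M(w₀)` for free)
import Summits.HodgeConjecture.HodgeConjecture.Theorems.K2E1UnipotentHaarNormalisationU2    -- ★ (D1-a) `isInvInvariant_of_isHaarMeasure_two`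
import Summits.HodgeConjecture.HodgeConjecture.Theorems.K2E1BruhatCosetsU                   -- ★ `exists_equiv_option_borelQuotient_two` (`n ↦ [w₀ n]` injective)
import Literature.NumberTheory.Automorphic.UnitaryGroupLineKAverageArchSmoothTwo            -- ★ the TUBE LEMMA `exists_levelIdeal_forall_conj_line_traceZeroLine_mem_two`, `continuous_coe_middleRootUnipotent_two`
import Literature.NumberTheory.Automorphic.UnitaryGroupLineHaarNormalisationTwo             -- ★ `integrable_comp_line_iff_two`
import Literature.NumberTheory.Automorphic.UnitaryGroupCuspIntegralSiegelMajorant           -- ★ `borelHeight_mul_of_mem_comap_standardMaximalCompactGL`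
import Literature.NumberTheory.Automorphic.FiniteAdeleSchwartzBruhatFourier                 -- ★ `finiteAdeleInr : 𝔸_F^∞ →ₙ+* 𝔸_F`, `b ↦ (0, b)`
import HarnessLib

/-!
# h413 ∕ Track B «K2-LIT», «EIS-RANK-ONE» R6d₂ (D1-c) PART I — `K2E1FlatSectionLineRestrictionU2`:
# the big-cell section along the line `Φ_g(t) = f(ι(w₀)·n(θ t)·g)` on `𝔸_F` (`U(J₂)`): level periodicity, continuity, integrability, `hloc`

Cell `pub/hodgecm-mathlib`, crux H413 = `stmt-HodgeConjecture-24833`, route `HCCMUnconditional`; dealer K2E1-plan (g3), deal [D1] 05:34:55Z, ruling «R6d-FIBREWISE»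
05:44:38Z; REPORT-FIRST 05:5xZ.  THEOREMS ONLY (no `def`, no `instance`, no `notation`, no named-fact hypothesis, no `sorry`); lane `--kind proof --supports
stmt-HodgeConjecture-24833 --as helper` (count-neutral).

THE OBJECT.  For `f : U(J₂)(𝔸_F) → ℂ` (a flat section `f_z = flatSectionU φ z` in the application) and `g ∈ U(J₂)(𝔸_F)` the BIG-CELL FUNCTION ALONG THE LINE is
`Φ_g(t) := f(ι(w₀) · n(θ t) · g)`, `t ∈ 𝔸_F = F_∞ × 𝔸_F^∞`, where `θ = traceZeroLine : 𝔸_F ≃ₜ+ 𝔸_E⁻` and `n = middleRootUnipotent : 𝔸_E⁻ ≅ N(𝔸_F)` (★; spelled out below, no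
definition).  It is the `Φ` of Poisson summation in ★ R6d₂ (a) `K2E1EisensteinMinusConstantTermPoissonU2` and of the cusp bound ★ `K2E1EisensteinMinusConstantTermCuspBoundU2`;
the fibrewise envelope lemma (D1-b) `K2E1AdelicFourierEnvelope` (K2E4-p10 (g3)) turns three properties of `Φ_k` — (i) integrability, (ii) periodicity of the finite
coordinate under a level ideal `𝔫𝒪̂_F`, (iii″) archimedean Fourier decay fibre by fibre — into membership of `𝓕Φ_k` in the decay class of ★ `K2E1AdelicFourierDecay`,
uniformly in `k ∈ K`.  THIS FILE proves (i), (ii) and the two further Poisson binders `hΦc`, `hloc` of ★ (a) for EVERY `f` with the stated invariance ∕ majorant, with NO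
archimedean analysis; (iii″) (from an archimedean smoothness binder `hφ∞` on `φ`) is PART II.

* §1 LINE ALGEBRA: `weylLong_mul_chart_add_mul` — `ι(w₀)·n(θ(x+u))·g = (ι(w₀)·n(θ x)·g) · (g⁻¹·n(θ u)·g)` (★ `chart_add`); `flatSectionU_mul_of_mem` — flat sections of a
  right-`U`-invariant `φ` are right-`U`-invariant for `U ≤ K_U` (★ `borelHeight_mul_of_mem_comap_standardMaximalCompactGL`).
* §2 (ii) **`exists_levelIdeal_forall_line_periodic_two`** (and the fibre-coordinate reading `…_two'`) — for a compact `K ⊆ G(𝔸_F)`, an open subgroup `U` and a right-`U`-invariant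
  `f` there is ONE ideal `𝔫 ≠ 0` with `Φ_k(x + (0,l)) = Φ_k(x)`, i.e. `Φ_k(a, b + l) = Φ_k(a, b)`, for all `k ∈ K`, `x = (a,b) ∈ 𝔸_F`, `l ∈ 𝔫𝒪̂_F` (★ TUBE LEMMA
  `exists_levelIdeal_forall_conj_line_traceZeroLine_mem_two`: `k⁻¹ n(θ(0,l)) k ∈ U`).
* §3 (i) `continuous_weylLong_mul_line_mul` (`hΦc`); **`integrable_line_iff_two`** — `Integrable (t ↦ T(n(θ t))) μ ↔ Integrable T ν` for additive Haar `μ` on `𝔸_F` and Haar `ν` on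
  `N(𝔸_F)` (★ `integrable_comp_line_iff_two` at `μY := θ_* μ`); **`integrable_weylLong_mul_mul_two`** — Godement's finiteness `hfin` at `g` ALONE makes `v ↦ f(ι(w₀) v g)`
  integrable on `N(𝔸_F)` (★ `integrable_intertwiningU_integrand_quasiSplit_two` at `(f ∘ inv, g⁻¹)` + inversion invariance ★ (D1-a)); hence **`integrable_weylLong_mul_line_mul_two`**
  = the `hΦi` binder of ★ (a) on `𝔸_F`, from `hfin` alone.
* §4 **`exists_summable_majorant_line_translate_two`** = the `hloc` binder of ★ (a): from a LOCALLY UNIFORM summable majorant of the left Eisenstein terms `q ↦ f(ι(q̃)·y)`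
  (★ R4a ∕ R2 shape, e.g. ★ `exists_locallyUniform_majorant_flatSectionU_cm_two`), for every compact `C ⊆ 𝔸_F` and every `g` ONE summable `u : F → ℝ` with
  `‖Φ_g(x + ξ)‖ ≤ u(ξ)` for `x ∈ C`, `ξ ∈ F` (finite subcover of the compact `n(θ C)·g`; `Φ_g(x + ξ) = f(ι(w₀ n_E(ξδ))·n(θ x)·g)` ★ `toAdelic_eq_chart_of_coe_eq`; `ξ ↦ [w₀ n_E(ξδ)]`
  is injective into `B(F)∖G(F)` ★ `exists_equiv_option_borelQuotient_two`; representative independence ★ `eisensteinSeriesU_term_eq`; Mathlib `Summable.comp_injective`).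

HONEST LABEL.  Count-neutral helper; proves no printed statement; HC_CM is proved only modulo the 7 printed citations (2 remaining named inputs: hLiu418 =
`stmt-HodgeConjecture-24832`, h413 = `stmt-HodgeConjecture-24833`) until rung 0 closes.

## References
* [MoeglinWaldspurger1995] C. Mœglin, J.-L. Waldspurger, *Spectral decomposition and Eisenstein series* (1995), I.2.6, II.1.5, II.1.7.
* [Garrett2018] P. Garrett, *Modern Analysis of Automorphic Forms by Example* 1 (2018), §2.8–§2.9 (`E − E_P` through the big cell and Poisson summation).
* [Rogawski1990] J. D. Rogawski, *Automorphic Representations of Unitary Groups in Three Variables* (1990), §1.10, §7.3 (pp. 97–98).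
* [WeilBNT1967] A. Weil, *Basic Number Theory* (1967), Ch. VII §2 (level ideals, the tube lemma).
-/

set_option autoImplicit false
set_option linter.dupNamespace false  -- the mandated namespace repeats the summit's segment (`HodgeConjecture.HodgeConjecture`)

noncomputable section

open MeasureTheory Measure Filter Topology NumberField IsDedekindDomain MulAction
open Literature.NumberTheory.Automorphic Literature.NumberTheory.Automorphic.UnitaryGroup
open Summit.HodgeConjecture.HodgeConjecture.Cruxes.H413.K2E1BorelEisensteinU
open Summit.HodgeConjecture.HodgeConjecture.Cruxes.H413.K2E1EisensteinSeriesLeftRight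
open Summit.HodgeConjecture.HodgeConjecture.Cruxes.H413.K2E1EisensteinMinusConstantTermPoissonU2
open Summit.HodgeConjecture.HodgeConjecture.Cruxes.H413.K2E1BigCellLineDilationU2
open Summit.HodgeConjecture.HodgeConjecture.Cruxes.H413.K2E1UnipotentHaarNormalisationU2
open Summit.HodgeConjecture.HodgeConjecture.Cruxes.H413.K2E1EisensteinIntertwiningU
open Summit.HodgeConjecture.HodgeConjecture.Cruxes.H413.K2E1BruhatCosetsU
open scoped ENNReal NNReal

namespace Summit.HodgeConjecture.HodgeConjecture.Cruxes.H413.K2E1FlatSectionLineRestrictionU2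

variable {F E : Type} [Field F] [NumberField F] [Field E] [NumberField E] [Algebra F E] [Algebra.IsQuadraticExtension F E] {c : E ≃ₐ[F] E}
  (hij : (((0 : Fin 2) : ℕ)) + 1 = ((1 : Fin 2) : ℕ)) (hN : 2 = 2 * ((0 : Fin 2) : ℕ) + 2) {δ : E}

/-! ## §1 Line algebra -/

/-- **`ι(w₀)·n(θ(x+u))·g = (ι(w₀)·n(θ x)·g) · (g⁻¹·n(θ u)·g)`** — translating the line variable is right multiplication by a `g`-CONJUGATE of the line
(★ `chart_add`: `n(θ(x+u)) = n(θ x)·n(θ u)`). [cite: Rogawski1990, §1.10] -/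
theorem weylLong_mul_chart_add_mul (hcδ : c δ = -δ) (hδ : δ ≠ 0) (x u : AdeleRing (𝓞 F) F) (g : (quasiSplit F E c 2).Adelic) :
    ((quasiSplit F E c 2).toAdelic (weylLongU (c : E →+* E) (rfl : ((StdForm.antidiagonal 2).over E) = ((StdForm.antidiagonal 2).over E)))) *
        ((middleRootUnipotent hij hN (Multiplicative.ofAdd (traceZeroLine F E c hcδ hδ (x + u))) : ↥(adelicUnipotent F E c 2)) : (quasiSplit F E c 2).Adelic) * g =
      ((quasiSplit F E c 2).toAdelic (weylLongU (c : E →+* E) (rfl : ((StdForm.antidiagonal 2).over E) = ((StdForm.antidiagonal 2).over E)))) *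
          ((middleRootUnipotent hij hN (Multiplicative.ofAdd (traceZeroLine F E c hcδ hδ x)) : ↥(adelicUnipotent F E c 2)) : (quasiSplit F E c 2).Adelic) * g *
        (g⁻¹ * ((middleRootUnipotent hij hN (Multiplicative.ofAdd (traceZeroLine F E c hcδ hδ u)) : ↥(adelicUnipotent F E c 2)) : (quasiSplit F E c 2).Adelic) * g) := by
  rw [chart_add hij hN hcδ hδ x u]
  group

omit [Algebra.IsQuadraticExtension F E] in
/-- **Flat sections of a right-`U`-invariant `φ` are right-`U`-invariant** for `U ≤ K_U = adelicVal⁻¹(K_∞·GL_N(𝒪̂_E))` (the height is right-`K_U`-invariant, ★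
`borelHeight_mul_of_mem_comap_standardMaximalCompactGL`). Any `N ≥ 1`. [cite: MoeglinWaldspurger1995, II.1.5] [cite: Garrett2018, §2.8] -/
theorem flatSectionU_mul_of_mem {N : ℕ} [NeZero N] {U : Subgroup (quasiSplit F E c N).Adelic}
    (hU : U ≤ (standardMaximalCompactGL N E).comap (adelicVal F E c N ((StdForm.antidiagonal N).over E)))
    {φ : (quasiSplit F E c N).Adelic → ℂ} (hφU : ∀ u ∈ U, ∀ y : (quasiSplit F E c N).Adelic, φ (y * u) = φ y) (z : ℂ) :
    ∀ u ∈ U, ∀ y : (quasiSplit F E c N).Adelic, flatSectionU φ z (y * u) = flatSectionU φ z y := fun u hu y => by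
  rw [flatSectionU_apply, flatSectionU_apply, hφU u hu y, borelHeight_mul_of_mem_comap_standardMaximalCompactGL (hU hu) y]

/-! ## §2 (ii) Level periodicity of the finite coordinate, uniformly on a compact set of `k` -/

/-- **(ii) LEVEL PERIODICITY, UNIFORM IN `k ∈ K`.**  For a compact `K ⊆ U(J₂)(𝔸_F)`, an open subgroup `U` and a right-`U`-invariant `f` there is an ideal `𝔫 ≠ 0` of `𝓞_F`
with `f(ι(w₀)·n(θ(x + (0, l)))·k) = f(ι(w₀)·n(θ x)·k)` for every `k ∈ K`, every `x ∈ 𝔸_F` and every `l ∈ 𝔫𝒪̂_F` (★ `levelIdeal`; `(0, l) = finiteAdeleInr F l`, ★, the adele with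
trivial archimedean part): by §1 the translate is right multiplication by `k⁻¹·n(θ(0,l))·k`, which the TUBE LEMMA (★ `exists_levelIdeal_forall_conj_line_traceZeroLine_mem_two`) puts in `U` for one
`𝔫` serving all of `K`. [cite: WeilBNT1967, Ch. VII §2] [cite: Rogawski1990, §7.3 (pp. 97–98)] [cite: MoeglinWaldspurger1995, II.1.7] -/
theorem exists_levelIdeal_forall_line_periodic_two (hcδ : c δ = -δ) (hδ : δ ≠ 0)
    {K : Set (quasiSplit F E c 2).Adelic} (hK : IsCompact K) {U : Subgroup (quasiSplit F E c 2).Adelic} (hUo : IsOpen (U : Set (quasiSplit F E c 2).Adelic))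
    {α : Type*} {f : (quasiSplit F E c 2).Adelic → α} (hfU : ∀ u ∈ U, ∀ y : (quasiSplit F E c 2).Adelic, f (y * u) = f y) :
    ∃ 𝔫 : Ideal (𝓞 F), 𝔫 ≠ 0 ∧ ∀ k ∈ K, ∀ x : AdeleRing (𝓞 F) F, ∀ l ∈ levelIdeal F 𝔫,
      f (((quasiSplit F E c 2).toAdelic (weylLongU (c : E →+* E) (rfl : ((StdForm.antidiagonal 2).over E) = ((StdForm.antidiagonal 2).over E)))) *
          ((middleRootUnipotent hij hN (Multiplicative.ofAdd (traceZeroLine F E c hcδ hδ (x + finiteAdeleInr F l))) : ↥(adelicUnipotent F E c 2)) :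
            (quasiSplit F E c 2).Adelic) * k) =
        f (((quasiSplit F E c 2).toAdelic (weylLongU (c : E →+* E) (rfl : ((StdForm.antidiagonal 2).over E) = ((StdForm.antidiagonal 2).over E)))) *
          ((middleRootUnipotent hij hN (Multiplicative.ofAdd (traceZeroLine F E c hcδ hδ x)) : ↥(adelicUnipotent F E c 2)) :
            (quasiSplit F E c 2).Adelic) * k) := by
  obtain ⟨𝔫, h𝔫, hmem⟩ := exists_levelIdeal_forall_conj_line_traceZeroLine_mem_two hij hN hcδ hδ hK (U := (U : Set (quasiSplit F E c 2).Adelic)) hUo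
    (SetLike.mem_coe.2 U.one_mem)
  refine ⟨𝔫, h𝔫, fun k hk x l hl => ?_⟩
  have hmem' := SetLike.mem_coe.1 (hmem l hl k hk)
  rw [← finiteAdeleInr_apply] at hmem'
  rw [weylLong_mul_chart_add_mul hij hN hcδ hδ x (finiteAdeleInr F l) k]
  exact hfU _ hmem' _

/-- **(ii) in fibre coordinates**: the same with `x = (a, b)`, reading `f(ι(w₀)·n(θ(a, b + l))·k) = f(ι(w₀)·n(θ(a, b))·k)` for `a ∈ F_∞`, `b ∈ 𝔸_F^∞`, `l ∈ 𝔫𝒪̂_F` — the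
level-periodicity hypothesis of the fibrewise envelope lemma (D1-b). [cite: WeilBNT1967, Ch. VII §2] [cite: MoeglinWaldspurger1995, II.1.7] -/
theorem exists_levelIdeal_forall_line_periodic_two' (hcδ : c δ = -δ) (hδ : δ ≠ 0)
    {K : Set (quasiSplit F E c 2).Adelic} (hK : IsCompact K) {U : Subgroup (quasiSplit F E c 2).Adelic} (hUo : IsOpen (U : Set (quasiSplit F E c 2).Adelic))
    {α : Type*} {f : (quasiSplit F E c 2).Adelic → α} (hfU : ∀ u ∈ U, ∀ y : (quasiSplit F E c 2).Adelic, f (y * u) = f y) :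
    ∃ 𝔫 : Ideal (𝓞 F), 𝔫 ≠ 0 ∧ ∀ k ∈ K, ∀ (a : InfiniteAdeleRing F) (b : FiniteAdeleRing (𝓞 F) F), ∀ l ∈ levelIdeal F 𝔫,
      f (((quasiSplit F E c 2).toAdelic (weylLongU (c : E →+* E) (rfl : ((StdForm.antidiagonal 2).over E) = ((StdForm.antidiagonal 2).over E)))) *
          ((middleRootUnipotent hij hN (Multiplicative.ofAdd (traceZeroLine F E c hcδ hδ ((a, b + l) : AdeleRing (𝓞 F) F))) : ↥(adelicUnipotent F E c 2)) :
            (quasiSplit F E c 2).Adelic) * k) =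
        f (((quasiSplit F E c 2).toAdelic (weylLongU (c : E →+* E) (rfl : ((StdForm.antidiagonal 2).over E) = ((StdForm.antidiagonal 2).over E)))) *
          ((middleRootUnipotent hij hN (Multiplicative.ofAdd (traceZeroLine F E c hcδ hδ ((a, b) : AdeleRing (𝓞 F) F))) : ↥(adelicUnipotent F E c 2)) :
            (quasiSplit F E c 2).Adelic) * k) := by
  obtain ⟨𝔫, h𝔫, hper⟩ := exists_levelIdeal_forall_line_periodic_two hij hN hcδ hδ hK hUo hfU
  refine ⟨𝔫, h𝔫, fun k hk a b l hl => ?_⟩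
  -- `(a, b + l) = (a, b) + (0, l)` in `𝔸_F`
  have hx : ((a, b + l) : AdeleRing (𝓞 F) F) =
      @HAdd.hAdd (AdeleRing (𝓞 F) F) (AdeleRing (𝓞 F) F) (AdeleRing (𝓞 F) F) instHAdd ((a, b) : AdeleRing (𝓞 F) F) (finiteAdeleInr F l) := by
    refine Prod.ext ?_ ?_
    · change a = a + 0
      rw [add_zero]
    · rfl
  rw [hx]
  exact hper k hk ((a, b) : AdeleRing (𝓞 F) F) l hl

/-! ## §3 (i) Continuity and integrability along the line -/

/-- **`hΦc`: `t ↦ f(ι(w₀)·n(θ t)·g)` is continuous** for continuous `f` (the chart is continuous, ★ `continuous_coe_middleRootUnipotent_two`, ★ `traceZeroLine`).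
[cite: Rogawski1990, §1.10] -/
theorem continuous_weylLong_mul_line_mul (hcδ : c δ = -δ) (hδ : δ ≠ 0) {α : Type*} [TopologicalSpace α] {f : (quasiSplit F E c 2).Adelic → α}
    (hf : Continuous f) (g : (quasiSplit F E c 2).Adelic) :
    Continuous fun t : AdeleRing (𝓞 F) F =>
      f (((quasiSplit F E c 2).toAdelic (weylLongU (c : E →+* E) (rfl : ((StdForm.antidiagonal 2).over E) = ((StdForm.antidiagonal 2).over E)))) *
        ((middleRootUnipotent hij hN (Multiplicative.ofAdd (traceZeroLine F E c hcδ hδ t)) : ↥(adelicUnipotent F E c 2)) : (quasiSplit F E c 2).Adelic) * g) :=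
  hf.comp ((continuous_const.mul ((continuous_coe_middleRootUnipotent_two hij hN).comp (traceZeroLine F E c hcδ hδ).continuous)).mul continuous_const)

section Integrable

variable [LocallyCompactSpace (AdeleRing (𝓞 E) E)]
  [MeasurableSpace (AdeleRing (𝓞 E) E)] [BorelSpace (AdeleRing (𝓞 E) E)]
  [MeasurableSpace (AdeleRing (𝓞 F) F)] [BorelSpace (AdeleRing (𝓞 F) F)]
  [MeasurableSpace (quasiSplit F E c 2).Adelic] [BorelSpace (quasiSplit F E c 2).Adelic]

/-- **INTEGRABILITY ALONG THE LINE IS INTEGRABILITY ON `N(𝔸_F)`**: for an additive Haar measure `μ` of `𝔸_F`, a Haar measure `ν` of `N(𝔸_F)` and any `T : N(𝔸_F) → V`,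
`Integrable (t ↦ T(n(θ t))) μ ↔ Integrable T ν` (★ `integrable_comp_line_iff_two` at the additive Haar measure `θ_* μ` of `𝔸_E⁻`, and `θ` is a measurable equivalence).
[cite: Rogawski1990, Prop. 7.3.1 (p. 98)] -/
theorem integrable_line_iff_two (hcδ : c δ = -δ) (hδ : δ ≠ 0)
    (μ : Measure (AdeleRing (𝓞 F) F)) [μ.IsAddHaarMeasure] (ν : Measure ↥(adelicUnipotent F E c 2)) [ν.IsHaarMeasure]
    {V : Type*} [NormedAddCommGroup V] (T : ↥(adelicUnipotent F E c 2) → V) :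
    Integrable (fun t : AdeleRing (𝓞 F) F => T (middleRootUnipotent hij hN (Multiplicative.ofAdd (traceZeroLine F E c hcδ hδ t)))) μ ↔ Integrable T ν := by
  set θ : AdeleRing (𝓞 F) F → traceZeroAdele F E c := fun x => traceZeroLine F E c hcδ hδ x with hθ
  haveI : (μ.map θ).IsAddHaarMeasure := (traceZeroLine F E c hcδ hδ).isAddHaarMeasure_map μ
  have hme : MeasurableEmbedding θ := (traceZeroLine F E c hcδ hδ).toHomeomorph.measurableEmbedding
  rw [← integrable_comp_line_iff_two hij hN (μ.map θ) ν T, hme.integrable_map_iff]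
  rfl

omit [Algebra.IsQuadraticExtension F E] [LocallyCompactSpace (AdeleRing (𝓞 E) E)] [MeasurableSpace (AdeleRing (𝓞 E) E)] [BorelSpace (AdeleRing (𝓞 E) E)]
  [MeasurableSpace (AdeleRing (𝓞 F) F)] [BorelSpace (AdeleRing (𝓞 F) F)] in
/-- **ABSOLUTE CONVERGENCE OF THE BIG-CELL INTEGRAL FROM GODEMENT'S FINITENESS ALONE**: for a Borel `f` left-invariant under `N(𝔸_F)` and `B(F)`, a left- and
inversion-invariant measure `ν` on `N(𝔸_F)` with a fundamental domain `𝓕` of `N(F)`, and `∫⁻_{u∈𝓕} Σ_{p∈Γ⧸B_Γ} ‖f(p̃⁻¹ u g)‖ dν < ∞` at the point `g`: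
`v ↦ f(ι(w₀)·v·g)` is `ν`-integrable (★ `integrable_intertwiningU_integrand_quasiSplit_two` at `(f ∘ inv, g⁻¹)`, then `v ↦ v⁻¹`). [cite: MoeglinWaldspurger1995, II.1.6] -/
theorem integrable_weylLong_mul_mul_two (ν : Measure ↥(adelicUnipotent F E c 2)) [ν.IsMulLeftInvariant] [ν.IsInvInvariant]
    {f : (quasiSplit F E c 2).Adelic → ℂ} (hfm : Measurable f)
    (hfN : ∀ (n : ↥(adelicUnipotent F E c 2)) (y : (quasiSplit F E c 2).Adelic), f ((n : (quasiSplit F E c 2).Adelic) * y) = f y)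
    (hfB : ∀ b ∈ borelU (c : E →+* E) ((StdForm.antidiagonal 2).over E), ∀ x : (quasiSplit F E c 2).Adelic, f ((quasiSplit F E c 2).toAdelic b * x) = f x)
    {𝓕 : Set ↥(adelicUnipotent F E c 2)} (h𝓕 : IsFundamentalDomain ↥(rationalUnipotent F E c 2) 𝓕 ν) (g : (quasiSplit F E c 2).Adelic)
    (hfin : ∫⁻ u in 𝓕, (∑' q : (quasiSplit F E c 2).quotientSubgroup ⧸ (borelAdelic F E c 2).subgroupOf (quasiSplit F E c 2).quotientSubgroup,
        ‖f ((((q.out : (quasiSplit F E c 2).quotientSubgroup) : (quasiSplit F E c 2).Adelic))⁻¹ * (u : (quasiSplit F E c 2).Adelic) * g)‖ₑ) ∂ν < ⊤) :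
    Integrable (fun v : ↥(adelicUnipotent F E c 2) =>
      f (((quasiSplit F E c 2).toAdelic (weylLongU (c : E →+* E) (rfl : ((StdForm.antidiagonal 2).over E) = ((StdForm.antidiagonal 2).over E)))) *
        (v : (quasiSplit F E c 2).Adelic) * g)) ν := by
  set φ : (quasiSplit F E c 2).Adelic → ℂ := fun y => f y⁻¹ with hφ
  have hφm : Measurable φ := hfm.comp measurable_inv
  have hφN : ∀ (y : (quasiSplit F E c 2).Adelic) (n : ↥(adelicUnipotent F E c 2)), φ (y * n) = φ y := fun y n => by
    simp only [hφ, _root_.mul_inv_rev, ← Subgroup.coe_inv]; exact hfN n⁻¹ y⁻¹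
  have hφB : ∀ (y : (quasiSplit F E c 2).Adelic) (b : (quasiSplit F E c 2).quotientSubgroup),
      b ∈ (borelAdelic F E c 2).subgroupOf (quasiSplit F E c 2).quotientSubgroup → φ (y * (b : (quasiSplit F E c 2).Adelic)) = φ y := fun y b hb => by
    simp only [hφ, _root_.mul_inv_rev]
    have key := apply_mul_of_mem_borelQuotient hfB (Subgroup.inv_mem _ hb) y⁻¹
    rwa [Subgroup.coe_inv] at key
  have hfin' : ∫⁻ u in 𝓕, (∑' q : (quasiSplit F E c 2).quotientSubgroup ⧸ (borelAdelic F E c 2).subgroupOf (quasiSplit F E c 2).quotientSubgroup,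
      ‖φ (g⁻¹ * (u : (quasiSplit F E c 2).Adelic)⁻¹ * ((q.out : (quasiSplit F E c 2).quotientSubgroup) : (quasiSplit F E c 2).Adelic))‖ₑ) ∂ν < ⊤ := by
    simpa only [hφ, _root_.mul_inv_rev, inv_inv, mul_assoc] using hfin
  have hI := (integrable_intertwiningU_integrand_quasiSplit_two ν hφm hφN hφB h𝓕 g⁻¹ hfin').comp_inv
  refine hI.congr (Eventually.of_forall fun v => ?_)
  simp only [hφ, _root_.mul_inv_rev, inv_inv, Subgroup.coe_inv, mul_assoc]

/-- **`hΦi`: THE BIG-CELL FUNCTION ALONG THE LINE IS INTEGRABLE ON `𝔸_F` from Godement's finiteness alone** (for a Haar measure `ν` of `N(𝔸_F)` — inversion invariant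
by ★ (D1-a) — and an additive Haar measure `μ` of `𝔸_F`): `Integrable (t ↦ f(ι(w₀)·n(θ t)·g)) μ`. [cite: MoeglinWaldspurger1995, II.1.6–II.1.7] [cite: Garrett2018, §2.8] -/
theorem integrable_weylLong_mul_line_mul_two (hcδ : c δ = -δ) (hδ : δ ≠ 0)
    (μ : Measure (AdeleRing (𝓞 F) F)) [μ.IsAddHaarMeasure] (ν : Measure ↥(adelicUnipotent F E c 2)) [ν.IsHaarMeasure]
    {f : (quasiSplit F E c 2).Adelic → ℂ} (hfm : Measurable f)
    (hfN : ∀ (n : ↥(adelicUnipotent F E c 2)) (y : (quasiSplit F E c 2).Adelic), f ((n : (quasiSplit F E c 2).Adelic) * y) = f y)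
    (hfB : ∀ b ∈ borelU (c : E →+* E) ((StdForm.antidiagonal 2).over E), ∀ x : (quasiSplit F E c 2).Adelic, f ((quasiSplit F E c 2).toAdelic b * x) = f x)
    {𝓕 : Set ↥(adelicUnipotent F E c 2)} (h𝓕 : IsFundamentalDomain ↥(rationalUnipotent F E c 2) 𝓕 ν) (g : (quasiSplit F E c 2).Adelic)
    (hfin : ∫⁻ u in 𝓕, (∑' q : (quasiSplit F E c 2).quotientSubgroup ⧸ (borelAdelic F E c 2).subgroupOf (quasiSplit F E c 2).quotientSubgroup,
        ‖f ((((q.out : (quasiSplit F E c 2).quotientSubgroup) : (quasiSplit F E c 2).Adelic))⁻¹ * (u : (quasiSplit F E c 2).Adelic) * g)‖ₑ) ∂ν < ⊤) :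
    Integrable (fun t : AdeleRing (𝓞 F) F =>
      f (((quasiSplit F E c 2).toAdelic (weylLongU (c : E →+* E) (rfl : ((StdForm.antidiagonal 2).over E) = ((StdForm.antidiagonal 2).over E)))) *
        ((middleRootUnipotent hij hN (Multiplicative.ofAdd (traceZeroLine F E c hcδ hδ t)) : ↥(adelicUnipotent F E c 2)) : (quasiSplit F E c 2).Adelic) * g)) μ := by
  haveI := isInvInvariant_of_isHaarMeasure_two (F := F) (E := E) (c := c) ν
  exact (integrable_line_iff_two hij hN hcδ hδ μ ν (fun v : ↥(adelicUnipotent F E c 2) =>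
    f (((quasiSplit F E c 2).toAdelic (weylLongU (c : E →+* E) (rfl : ((StdForm.antidiagonal 2).over E) = ((StdForm.antidiagonal 2).over E)))) *
      (v : (quasiSplit F E c 2).Adelic) * g))).2 (integrable_weylLong_mul_mul_two ν hfm hfN hfB h𝓕 g hfin)

end Integrable

/-! ## §4 Poisson's locally uniform majorant `hloc` from the Eisenstein majorant -/

omit [Algebra.IsQuadraticExtension F E] in
/-- A locally uniform summable majorant is uniform on compact sets (finite subcover; the finitely many majorants are non-negative at their base points and add up).
[folklore] -/
theorem exists_summable_majorant_on_isCompact {Q : Type*} {f : (quasiSplit F E c 2).Adelic → ℂ}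
    {T : Q → (quasiSplit F E c 2).Adelic → (quasiSplit F E c 2).Adelic}
    (hmaj : ∀ y₀ : (quasiSplit F E c 2).Adelic, ∃ U ∈ 𝓝 y₀, ∃ u : Q → ℝ, Summable u ∧ ∀ y ∈ U, ∀ q, ‖f (T q y)‖ ≤ u q)
    {S : Set (quasiSplit F E c 2).Adelic} (hS : IsCompact S) :
    ∃ u : Q → ℝ, Summable u ∧ ∀ y ∈ S, ∀ q, ‖f (T q y)‖ ≤ u q := by
  classical
  choose U hU u hu hle using hmaj
  obtain ⟨t, -, hcover⟩ := hS.elim_nhds_subcover U fun y _ => hU y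
  refine ⟨fun q => ∑ y₀ ∈ t, u y₀ q, summable_sum fun y₀ _ => hu y₀, fun y hy q => ?_⟩
  obtain ⟨y₁, hy₁, hyU⟩ := Set.mem_iUnion₂.1 (hcover hy)
  refine (hle y₁ y hyU q).trans ?_
  exact Finset.single_le_sum (f := fun y₀ => u y₀ q) (fun y₀ _ => (norm_nonneg _).trans (hle y₀ y₀ (mem_of_mem_nhds (hU y₀)) q)) hy₁

/-- **`hloc`: POISSON'S LOCALLY UNIFORM MAJORANT OF THE `F`-TRANSLATES** of `Φ_g(t) = f(ι(w₀)·n(θ t)·g)`.  If the left Eisenstein terms `q ↦ f(ι(q̃)·y)` of a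
left-`B(F)`-invariant `f` admit a locally uniform summable majorant on `B(F)∖U(J₂)(F)` (★ R4a ∕ R2 shape), then for every compact `C ⊆ 𝔸_F` and every `g` there is ONE summable
`u : F → ℝ` with `‖Φ_g(x + ξ)‖ ≤ u(ξ)` for all `x ∈ C`, `ξ ∈ F`: `Φ_g(x + ξ) = f(ι(w₀ n_E(ξδ)) · (n(θ x) g))` is the Eisenstein term at the big-cell coset `[w₀ n_E(ξδ)]`
(★ `toAdelic_eq_chart_of_coe_eq`, ★ `eisensteinSeriesU_term_eq`), `ξ ↦ [w₀ n_E(ξδ)]` is injective (★ `exists_equiv_option_borelQuotient_two`), and `n(θ C)·g` is compact.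
[cite: Garrett2018, §2.8–§2.9] [cite: MoeglinWaldspurger1995, II.1.7] [cite: CasselsFrohlichANT1967, Ch. XV Lemma 4.2.4] -/
theorem exists_summable_majorant_line_translate_two (hcδ : c δ = -δ) (hδ : δ ≠ 0) {f : (quasiSplit F E c 2).Adelic → ℂ}
    (hfB : ∀ b ∈ borelU (c : E →+* E) ((StdForm.antidiagonal 2).over E), ∀ x : (quasiSplit F E c 2).Adelic, f ((quasiSplit F E c 2).toAdelic b * x) = f x)
    (hmaj : ∀ y₀ : (quasiSplit F E c 2).Adelic, ∃ U ∈ 𝓝 y₀,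
      ∃ u : Quotient (orbitRel ↥(borelU (c : E →+* E) ((StdForm.antidiagonal 2).over E)) ↥(unitaryGroupOfForm (c : E →+* E) ((StdForm.antidiagonal 2).over E))) → ℝ,
        Summable u ∧ ∀ y ∈ U, ∀ q, ‖f ((quasiSplit F E c 2).toAdelic (q.out : ↥(unitaryGroupOfForm (c : E →+* E) ((StdForm.antidiagonal 2).over E))) * y)‖ ≤ u q)
    {C : Set (AdeleRing (𝓞 F) F)} (hC : IsCompact C) (g : (quasiSplit F E c 2).Adelic) :
    ∃ u : F → ℝ, Summable u ∧ ∀ x ∈ C, ∀ ξ : F,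
      ‖f (((quasiSplit F E c 2).toAdelic (weylLongU (c : E →+* E) (rfl : ((StdForm.antidiagonal 2).over E) = ((StdForm.antidiagonal 2).over E)))) *
          ((middleRootUnipotent hij hN (Multiplicative.ofAdd (traceZeroLine F E c hcδ hδ (x + algebraMap F (AdeleRing (𝓞 F) F) ξ))) : ↥(adelicUnipotent F E c 2)) :
            (quasiSplit F E c 2).Adelic) * g)‖ ≤ u ξ := by
  classical
  -- the compact set `n(θ C) · g` and a uniform majorant on it
  set Y : AdeleRing (𝓞 F) F → (quasiSplit F E c 2).Adelic := fun x =>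
    ((middleRootUnipotent hij hN (Multiplicative.ofAdd (traceZeroLine F E c hcδ hδ x)) : ↥(adelicUnipotent F E c 2)) : (quasiSplit F E c 2).Adelic) * g with hY
  have hYc : Continuous Y := ((continuous_coe_middleRootUnipotent_two hij hN).comp (traceZeroLine F E c hcδ hδ).continuous).mul continuous_const
  obtain ⟨uQ, huQ, hleQ⟩ := exists_summable_majorant_on_isCompact
    (T := fun (q : Quotient (orbitRel ↥(borelU (c : E →+* E) ((StdForm.antidiagonal 2).over E)) ↥(unitaryGroupOfForm (c : E →+* E) ((StdForm.antidiagonal 2).over E))))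
      (y : (quasiSplit F E c 2).Adelic) => (quasiSplit F E c 2).toAdelic (q.out : ↥(unitaryGroupOfForm (c : E →+* E) ((StdForm.antidiagonal 2).over E))) * y)
    hmaj (hC.image hYc)
  -- the rational line `ξ ↦ n_E(ξδ)` and its big-cell cosets `ξ ↦ [w₀ n_E(ξδ)]`, injective
  choose nE hnE using fun ξ : F => exists_unipotentU_two_coe_eq (E := E) (c := c) hcδ ξ
  obtain ⟨e, -, he⟩ := exists_equiv_option_borelQuotient_two (c : E →+* E) (rfl : ((StdForm.antidiagonal 2).over E) = ((StdForm.antidiagonal 2).over E))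
  set qξ : F → Quotient (orbitRel ↥(borelU (c : E →+* E) ((StdForm.antidiagonal 2).over E)) ↥(unitaryGroupOfForm (c : E →+* E) ((StdForm.antidiagonal 2).over E))) :=
    fun ξ => Quotient.mk _ (weylLongU (c : E →+* E) (rfl : ((StdForm.antidiagonal 2).over E) = ((StdForm.antidiagonal 2).over E)) *
      (nE ξ : ↥(unitaryGroupOfForm (c : E →+* E) ((StdForm.antidiagonal 2).over E)))) with hqξ
  have hq_inj : Function.Injective qξ := by
    intro ξ ξ' h
    have h' : e (some (nE ξ)) = e (some (nE ξ')) := by rw [he, he]; exact h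
    have hn : nE ξ = nE ξ' := Option.some_injective _ (e.injective h')
    have h01 := congrFun (congrFun (congrArg (fun n : ↥(unipotentU (c : E →+* E) ((StdForm.antidiagonal 2).over E)) =>
      (((n : ↥(unitaryGroupOfForm (c : E →+* E) ((StdForm.antidiagonal 2).over E))) : GL (Fin 2) E) : Matrix (Fin 2) (Fin 2) E)) hn) 0) 1
    have h01' : algebraMap F E ξ * δ = algebraMap F E ξ' * δ := by simpa [hnE] using h01
    exact (algebraMap F E).injective (mul_right_cancel₀ hδ h01')
  refine ⟨fun ξ => uQ (qξ ξ), huQ.comp_injective hq_inj, fun x hx ξ => ?_⟩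
  -- `Φ_g(x + ξ) = f(ι(w₀ n_E(ξδ)) · Y x)`, the Eisenstein term at the coset `[w₀ n_E(ξδ)]`
  have hsplit : ((quasiSplit F E c 2).toAdelic (weylLongU (c : E →+* E) (rfl : ((StdForm.antidiagonal 2).over E) = ((StdForm.antidiagonal 2).over E)))) *
      ((middleRootUnipotent hij hN (Multiplicative.ofAdd (traceZeroLine F E c hcδ hδ (x + algebraMap F (AdeleRing (𝓞 F) F) ξ))) : ↥(adelicUnipotent F E c 2)) :
        (quasiSplit F E c 2).Adelic) * g =
      (quasiSplit F E c 2).toAdelic (weylLongU (c : E →+* E) (rfl : ((StdForm.antidiagonal 2).over E) = ((StdForm.antidiagonal 2).over E)) *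
        (nE ξ : ↥(unitaryGroupOfForm (c : E →+* E) ((StdForm.antidiagonal 2).over E)))) * Y x := by
    have hmul : (quasiSplit F E c 2).toAdelic (weylLongU (c : E →+* E) (rfl : ((StdForm.antidiagonal 2).over E) = ((StdForm.antidiagonal 2).over E)) *
        (nE ξ : ↥(unitaryGroupOfForm (c : E →+* E) ((StdForm.antidiagonal 2).over E)))) =
      ((quasiSplit F E c 2).toAdelic (weylLongU (c : E →+* E) (rfl : ((StdForm.antidiagonal 2).over E) = ((StdForm.antidiagonal 2).over E)))) *
        (quasiSplit F E c 2).toAdelic (nE ξ : ↥(unitaryGroupOfForm (c : E →+* E) ((StdForm.antidiagonal 2).over E))) := map_mul _ _ _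
    rw [hmul, toAdelic_eq_chart_of_coe_eq hij hN hcδ hδ (hnE ξ), add_comm x (algebraMap F (AdeleRing (𝓞 F) F) ξ),
      chart_add hij hN hcδ hδ (algebraMap F (AdeleRing (𝓞 F) F) ξ) x]
    simp only [hY, mul_assoc]
  rw [hsplit, ← eisensteinSeriesU_term_eq hfB]
  exact hleQ (Y x) (Set.mem_image_of_mem Y hx) (qξ ξ)

end Summit.HodgeConjecture.HodgeConjecture.Cruxes.H413.K2E1FlatSectionLineRestrictionU2

end
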